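import Mathlib.Combinatorics.SimpleGraph.Metric
import Summits.AtomisticToContinuum.Crystallization.Theorems.FluxTubeKeplerFloorGivesLayered
import Summits.AtomisticToContinuum.Crystallization.Theorems.FluxTubeKeplerFluxCellKeplerSingleScale
import Summits.AtomisticToContinuum.Crystallization.Theorems.ChessboardParticlePlanesPeriodicWindowsIffCrystallization
import Summits.AtomisticToContinuum.Crystallization.Theorems.FluxTubeKeplerKeplerEnergyFloor

/-!
# Line `RebondingRung` (bond-topology ladder) — skeleton for the forward rung over `FluxTubeKepler.FloorGivesLayered`
(crux dir `FluxCellKepler`, stmt-AtomisticToContinuum-15221; fwd-rung G1 gen 14, seed g1-AtomisticToContinuum-15223)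

FLOOR (proved, `FluxTubeKeplerFloorGivesLayered.FloorGivesLayered_proof`): for every periodic `P₀`, the energy
floor `N·e(P₀) ≤ E(x)` on Lennard-Jones ground states together with the defect BUDGET
`c(R,η) · #{(R,η)-non-layered sites} ≤ E(x) − N·e(P₀)` — a Kepler-type certificate that prices EVERY site whose
`R`-ball is not two-way `η`-matched with a relaxed Barlow template — forces layered windows, hence (proved
`PeriodicGivenLayered`) periodic windows, along every ground-state sequence.  Its proof is potential-free:
`o(N)` counting (`eventually_exists_not_bad`), Bolzano–Weierstrass on the spacing, dilation covariance.

THE GRADED FAMILY `BondRung k` (ONE move — one hypothesis weakened: the SET OF PRICED SITES shrinks from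
"metrically bad" to "metrically bad AND topologically bad to depth `k`"):
* `BondGood k x i` — the rooted ball of radius `k` about `i` in the CONTACT GRAPH of `x` (bond = pair at distance
  `≤ 23/20`; the threshold separates the first shell `≤ 1.028` of every relaxed Barlow template from its second
  shell `≥ 1.31`) is isomorphic, root to root, to the rooted `k`-ball of the ideal Barlow contact graph of some
  Hägg word `s`; `BondGood 0 := False`;
* `BondBudget k P₀` prices only the sites that are `(R,η)`-non-layered AND not `BondGood k` — i.e. the REBONDED
  sites (wrong coordination, non-Barlow first-shell topology, dislocation cores, stacking of non-close-packed type,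
  grain boundaries, vacancies' neighbours, surfaces); sites inside an ELASTICALLY DEFORMED PERFECT CRYSTAL (Barlow
  bonding, arbitrary inhomogeneous strain / rotation field keeping every bond in `[7/10, 23/20]` and every non-bond
  `> 23/20`) are free, however far (`> η` over radius `R`) they sit from every rigid template;
* `BondRung 0` is the floor (`bondRung_zero`: `¬ BondGood 0` is `True`, the priced set is the floor's);
  every member implies the floor member (`bondRung_zero_of_bondRung`: the dial only removes priced sites);
  every member is a consequence of the sub-problem (`bondRung_of_crystallization`, on path, via the landed
  `periodicWindows_of_crystallization`);
* deciding rung `RebondingRung := ∃ k ≥ 1, BondRung k` — "a Kepler certificate that charges only REBONDING still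
  forces crystallization of the Lennard-Jones ground states".  The floor's counting cannot reach it: an un-priced
  site is now either metrically good OR merely topologically good, and a topologically perfect but strained crystal
  (e.g. `5 %` dilated fcc: bond-good to every depth, `(R,η)`-bad once `R > 20 η`) has no layered window; the new
  input is ENERGETIC and lives in the sector with NO competing phases: fixed-topology atomistic ELASTIC COERCIVITY
  (`stub_elasticCoercivity`: along ground states, bond-good but `(R,η)`-non-layered sites cost `≥ c'(k,R,η)` each
  on average, up to a debit `C` per rebonded site) — geometric rigidity (Friesecke–James–Müller) on the contact
  graph + Born / Cauchy–Born stability of the relaxed Barlow polytypes, never a comparison ACROSS bond topologies.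

Stubs (the only `sorry`s): `stub_bondOfLayered` (potential-free: metric goodness at tolerance `≤ 1/20` and radius
`≥ R₀(k)` implies bond-goodness to depth `k` on ground states — shell separation + hard core), `stub_elasticCoercivity`
(the new input); composition `RebondingRung_of` is sorry-free (counting at the finer scale `(max R R₀, min η 1/20)`,
then the seed `FloorGivesLayered_proof` + proved `PeriodicGivenLayered`).
-/

noncomputable section

namespace Summit.AtomisticToContinuum.Crystallization.Cruxes.FluxCellKepler.BondLadder

open scoped BigOperators Classical
open Filter Topology
open Literature.MathematicalPhysics.StatisticalMechanics
open Summit.AtomisticToContinuum.Crystallization.Theorems.FluxCellKeplerSingleScale (LayeredGood layeredGood_mono)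
open Summit.AtomisticToContinuum.Crystallization.Theorems.ChargedEnergyGapNegative (eStar)

local notation "E3" => EuclideanSpace ℝ (Fin 3)

/-! ## The objects of the ladder: contact graphs and rooted bond-topology -/

/-- The CONTACT GRAPH of a finite configuration: `i ~ j` iff `i ≠ j` and `dist (x i) (x j) ≤ 23/20`
(`SimpleGraph.fromRel`, so the adjacency unfolds to `i ≠ j ∧ (dist (x i) (x j) ≤ 23/20 ∨ dist (x j) (x i) ≤ 23/20)`).
On a `7/10`-separated configuration matched at tolerance `≤ 1/20` with a relaxed Barlow template the bonds are exactly
the template's first-shell pairs (first shell `≤ 1.028`, second shell `≥ 1.31`). -/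
def contactGraph {N : ℕ} (x : Fin N → E3) : SimpleGraph (Fin N) :=
  SimpleGraph.fromRel fun i j => dist (x i) (x j) ≤ 23 / 20

/-- The ideal position of the label `v = (m, k, l)` (layer `m`, in-plane coordinates `k, l`) in the Barlow stacking of
Hägg word `s` with touching unit balls (`a = 1`, `h = √(2/3)`). -/
def idealPos (s : ℤ → ℤ) (v : ℤ × ℤ × ℤ) : E3 :=
  barlowPos 1 (Real.sqrt (2 / 3)) s v.1 v.2.1 v.2.2

/-- The ideal BARLOW CONTACT GRAPH of Hägg word `s` on the label set `ℤ × ℤ × ℤ`: `v ~ w` iff the ideal positions are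
at distance `≤ 23/20` (equivalently `= 1`: six in-plane and three + three adjacent-layer neighbours). -/
def barlowGraph (s : ℤ → ℤ) : SimpleGraph (ℤ × ℤ × ℤ) :=
  SimpleGraph.fromRel fun v w => dist (idealPos s v) (idealPos s w) ≤ 23 / 20

/-- The (closed) ball of radius `k` about `v` in the graph metric (`SimpleGraph.edist`, `⊤` between different
components, so unreachable vertices are excluded). -/
def gball {V : Type*} (G : SimpleGraph V) (v : V) (k : ℕ) : Set V := {w | G.edist v w ≤ k}

/-- **BOND-GOOD TO DEPTH `k`** (`k ≥ 1`; `BondGood 0 := False`): the rooted `k`-ball of `i` in the contact graph of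
`x` is isomorphic — by a graph isomorphism of the induced subgraphs sending `i` to the origin — to the rooted
`k`-ball of the origin in the ideal Barlow contact graph of some Hägg word `s`.  A purely combinatorial, potential-free,
strain-blind datum. -/
def BondGood (k : ℕ) {N : ℕ} (x : Fin N → E3) (i : Fin N) : Prop :=
  0 < k ∧ ∃ s : ℤ → ℤ, IsHaggSeq s ∧
    ∃ φ : (contactGraph x).induce (gball (contactGraph x) i k) ≃g
          (barlowGraph s).induce (gball (barlowGraph s) (0 : ℤ × ℤ × ℤ) k),
      ∀ h : i ∈ gball (contactGraph x) i k, ((φ ⟨i, h⟩ : gball (barlowGraph s) (0 : ℤ × ℤ × ℤ) k) : ℤ × ℤ × ℤ) = 0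

/-! ## The rung family -/

/-- FLOOR(P₀): `N · e(P₀) ≤ E(x)` for every Lennard-Jones ground state `x` of every size `N`
(verbatim the first hypothesis of `FluxTubeKepler.FloorGivesLayered`). -/
def Floor (P₀ : PeriodicConfiguration 3) : Prop :=
  ∀ (N : ℕ) (x : Fin N → E3), IsGroundState lennardJones x →
    (N : ℝ) * P₀.energyPerParticle lennardJones ≤ interactionEnergy lennardJones x

/-- REBONDING BUDGET to depth `k`: for every radius `R > 0` and tolerance `η > 0` some `c > 0` prices the sites of
every Lennard-Jones ground state that are `(R,η)`-non-layered AND not bond-good to depth `k`, against the excess energy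
over `N · e(P₀)` (`k = 0`: the floor's budget, every non-layered site priced; quantifier order `∀ R η ∃ c` of the crux
kept, Disproof §5). -/
def BondBudget (k : ℕ) (P₀ : PeriodicConfiguration 3) : Prop :=
  ∀ R η : ℝ, 0 < R → 0 < η → ∃ c : ℝ, 0 < c ∧
    ∀ (N : ℕ) (x : Fin N → E3), IsGroundState lennardJones x →
      c * (Nat.card {i : Fin N // ¬ LayeredGood R η x i ∧ ¬ BondGood k x i} : ℝ) ≤
        interactionEnergy lennardJones x - (N : ℝ) * P₀.energyPerParticle lennardJones

/-- Periodic windows at every scale along the sequence `x` (ONE periodic `P`, translations only) —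
verbatim the conclusion of `FluxTubeKepler.PeriodicWindows` / `FluxTubeKepler.PeriodicGivenLayered`. -/
def HasPeriodicWindows (x : (N : ℕ) → (Fin N → E3)) : Prop :=
  ∃ P : PeriodicConfiguration 3, ∀ R ε : ℝ, 0 < ε → ∃ᶠ N in atTop, ∃ t : E3,
    (∀ q ∈ P.points, ‖q‖ ≤ R → ∃ i : Fin N, dist (x N i + t) q ≤ ε) ∧
    (∀ i : Fin N, ‖x N i + t‖ ≤ R → ∃ q ∈ P.points, dist (x N i + t) q ≤ ε)

/-- **The graded family.** `BondRung k`: FLOOR and the rebonding budget to depth `k` force periodic windows along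
every Lennard-Jones ground-state sequence. -/
def BondRung (k : ℕ) : Prop :=
  ∀ P₀ : PeriodicConfiguration 3, Floor P₀ → BondBudget k P₀ →
    ∀ x : (N : ℕ) → (Fin N → E3), (∀ N, IsGroundState lennardJones (x N)) → HasPeriodicWindows x

/-- **Deciding rung.** Some finite inspection depth suffices: a certificate blind to every elastically deformed
perfect crystal (Barlow bonding to depth `k`) still forces crystallization of the ground states. -/
def RebondingRung : Prop := ∃ k : ℕ, 0 < k ∧ BondRung k

/-! ## Counting helpers -/

theorem natCard_mono {N : ℕ} {p q : Fin N → Prop} (h : ∀ i, p i → q i) :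
    Nat.card {i // p i} ≤ Nat.card {i // q i} := by
  rw [Nat.card_eq_fintype_card, Nat.card_eq_fintype_card]
  exact Fintype.card_subtype_mono _ _ h

theorem natCard_or_le {N : ℕ} (p q : Fin N → Prop) :
    Nat.card {i // p i ∨ q i} ≤ Nat.card {i // p i} + Nat.card {i // q i} := by
  rw [Nat.card_eq_fintype_card, Nat.card_eq_fintype_card, Nat.card_eq_fintype_card]
  exact Fintype.card_subtype_or p q

/-- `LayeredGood` is monotone in the tolerance. [folklore] -/
theorem layeredGood_tol {R η η' : ℝ} (hη : η' ≤ η) {N : ℕ} (x : Fin N → E3) (i : Fin N) :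
    LayeredGood R η' x i → LayeredGood R η x i := by
  rintro ⟨a, ha₁, ha₂, A, s, z, hs, hz, h₁, h₂⟩
  refine ⟨a, ha₁, ha₂, A, s, z, hs, hz, ?_, ?_⟩
  · intro p hp hpR
    obtain ⟨j, hj⟩ := h₁ p hp hpR
    exact ⟨j, hj.trans hη⟩
  · intro j hj
    obtain ⟨p, hp, hjp⟩ := h₂ j hj
    exact ⟨p, hp, hjp.trans hη⟩

/-! ## F3 — the family specialises to the proved floor -/

/-- Depth `0` inspects nothing: `BondGood 0` is `False`. -/
@[simp] theorem not_bondGood_zero {N : ℕ} (x : Fin N → E3) (i : Fin N) : ¬ BondGood 0 x i :=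
  fun h => (lt_irrefl 0 h.1).elim

/-- At depth `0` the rebonding budget IS the floor's budget. -/
theorem bondBudget_zero_iff (P₀ : PeriodicConfiguration 3) :
    BondBudget 0 P₀ ↔
      ∀ R η : ℝ, 0 < R → 0 < η → ∃ c : ℝ, 0 < c ∧
        ∀ (N : ℕ) (x : Fin N → E3), IsGroundState lennardJones x →
          c * (Nat.card {i : Fin N // ¬ LayeredGood R η x i} : ℝ) ≤
            interactionEnergy lennardJones x - (N : ℝ) * P₀.energyPerParticle lennardJones := by
  simp only [BondBudget, not_bondGood_zero, not_false_eq_true, and_true]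

/-- `BondRung 0` is the floor: the seed theorem followed by the proved `PeriodicGivenLayered`. -/
theorem bondRung_zero : BondRung 0 := fun P₀ hF hB x hx =>
  Theses.FluxTubeKepler.PeriodicGivenLayered_holds x hx
    (Theorems.FluxTubeKeplerFloorGivesLayered.FloorGivesLayered_proof P₀ hF
      ((bondBudget_zero_iff P₀).1 hB) x hx)

/-! ## Dial: every member gives back the floor member (the dial only removes priced sites) -/

/-- The floor's budget prices a superset: `BondBudget 0 P₀ → BondBudget k P₀`. -/
theorem bondBudget_of_zero (k : ℕ) (P₀ : PeriodicConfiguration 3) : BondBudget 0 P₀ → BondBudget k P₀ := by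
  intro hB R η hR hη
  obtain ⟨c, hc, hcB⟩ := hB R η hR hη
  refine ⟨c, hc, fun N x hx => le_trans ?_ (hcB N x hx)⟩
  have hle : Nat.card {i : Fin N // ¬ LayeredGood R η x i ∧ ¬ BondGood k x i} ≤
      Nat.card {i : Fin N // ¬ LayeredGood R η x i ∧ ¬ BondGood 0 x i} :=
    natCard_mono fun i hi => ⟨hi.1, not_bondGood_zero x i⟩
  exact mul_le_mul_of_nonneg_left (by exact_mod_cast hle) hc.le

/-- Every member implies the floor member (informational `specialises`). -/
theorem bondRung_zero_of_bondRung {k : ℕ} (h : BondRung k) : BondRung 0 :=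
  fun P₀ hF hB x hx => h P₀ hF (bondBudget_of_zero k P₀ hB) x hx

/-- The deciding rung gives back the floor member. -/
theorem bondRung_zero_of_rebondingRung (h : RebondingRung) : BondRung 0 := by
  obtain ⟨k, -, hk⟩ := h
  exact bondRung_zero_of_bondRung hk

/-! ## F4 — on-path lemmas: the sub-problem implies every member -/

/-- ON-PATH: `Crystallization → BondRung k` (landed hull-criterion converse `periodicWindows_of_crystallization`). -/
theorem bondRung_of_crystallization (k : ℕ) (h : _root_.Crystallization) : BondRung k :=
  fun _ _ _ x hx =>
    Theorems.ChessboardParticlePlanesPeriodicWindowsIffCrystallization.periodicWindows_of_crystallization h x hx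

/-- ON-PATH for the deciding rung (tagged `aesop safe apply` so that the tribunal's fixed `S → C` portfolio finds it). -/
@[aesop safe apply]
theorem RebondingRung_of_Crystallization (h : _root_.Crystallization) : RebondingRung :=
  ⟨1, Nat.one_pos, bondRung_of_crystallization 1 h⟩

/-! ## How the rung relieves the parent crux `FluxCellKepler` (documentation, sorry-free)

With `BondRung k` in hand the route `FluxTubeKepler` needs its Kepler-type certificate only for REBONDED sites:
`BondKeplerFloor k` below is the conclusion of the PROVED `KeplerEnergyFloor` with the priced set cut down to
`{¬ LayeredGood ∧ ¬ BondGood k}`, and `BondRung k → BondKeplerFloor k → (periodic windows along ground states)`. -/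

/-- The floor-and-rebonding-budget package (what a topology-only Kepler certificate delivers). -/
def BondKeplerFloor (k : ℕ) : Prop := ∃ P₀ : PeriodicConfiguration 3, Floor P₀ ∧ BondBudget k P₀

theorem windows_of_bondRung {k : ℕ} (h : BondRung k) (hK : BondKeplerFloor k) :
    ∀ x : (N : ℕ) → (Fin N → E3), (∀ N, IsGroundState lennardJones (x N)) → HasPeriodicWindows x := by
  obtain ⟨P₀, hF, hB⟩ := hK
  exact fun x hx => h P₀ hF hB x hx

/-- The parent crux gives the package at every depth (proved `KeplerEnergyFloor` + minimal distance + the dial). -/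
theorem bondKeplerFloor_of_fluxCellKepler (k : ℕ) (hK : Theses.FluxTubeKepler.FluxCellKepler) :
    BondKeplerFloor k := by
  obtain ⟨P₀, hF, hB⟩ := Theorems.keplerEnergyFloor_proof hK LennardJonesMinimalDistance_holds
  exact ⟨P₀, hF, bondBudget_of_zero k P₀ ((bondBudget_zero_iff P₀).2 fun R η hR hη => hB R η hR hη)⟩

/-! ## The line: metric ⇒ topological goodness (potential-free) + elastic coercivity (the new input)

Two declared stubs. -/

/-- **Stub 1 — METRIC GOODNESS IMPLIES BOND-GOODNESS (potential-free).** For every depth `k ≥ 1` there is a radius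
`R₀ = R₀(k)` (`6k/5 + 2` will do) such that at every radius `R ≥ R₀` and tolerance `0 < η ≤ 1/20`, an
`(R,η)`-layered-good site of a Lennard-Jones ground state is bond-good to depth `k`: ground states are
`7/10`-separated (landed `minDist_seven_tenths` / `LennardJonesMinimalDistance`), so the two-way `η`-matching with the
template is a bijection near `i` moving points by `≤ 1/20`; template pairs are at distance `≤ 1.028` (first shell:
in-plane `a ≤ 1`, adjacent layers `√(a²/3 + h²) ≤ 1.0276` for `a ∈ [47/50,1]`, `h ∈ [39a/50, 17a/20]`) or `≥ 1.3098`
(second shell), so `dist ≤ 23/20` between matched particles holds iff the labels are first-shell neighbours — the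
contact graph on the `k`-ball is the ideal Barlow contact graph of the template's Hägg word, root to root. [folklore] -/
theorem stub_bondOfLayered :
    ∀ k : ℕ, 0 < k → ∃ R₀ : ℝ, ∀ R η : ℝ, R₀ ≤ R → 0 < η → η ≤ 1 / 20 →
      ∀ (N : ℕ) (x : Fin N → E3), IsGroundState lennardJones x →
        ∀ i : Fin N, LayeredGood R η x i → BondGood k x i := by
  sorry

/-- **Stub 2 — ELASTIC COERCIVITY AT FIXED BOND TOPOLOGY (the new input; load-bearing).** For some depth `k ≥ 1`:
at every scale `(R,η)` there are `c' > 0` and `C ≥ 0` such that along Lennard-Jones ground states the sites that are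
bond-good to depth `k` but NOT `(R,η)`-layered (elastically strained / rotated perfect crystal, out-of-box spacings)
cost at least `c'` each on average, up to a debit `C` per site that is not bond-good:
`c' · #{BondGood k ∧ ¬ LayeredGood R η} ≤ (E(x) − N·e⋆) + C · #{¬ BondGood k}`.
Route to it: (i) discrete geometric rigidity (Friesecke–James–Müller) on bond-good `R`-balls — an `(R,η)`-bad but
bond-good ball is `≥ c(R) η²` from `SO(3)`·(box family) in summed squared bond strain; (ii) local energy coercivity
within the Barlow bond topology — site-energy excess over `e⋆` controls squared bond strain up to boundary debits
(Born / phonon stability of the relaxed polytypes + a finite-dimensional certified computation for strains far from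
`SO(3)`; tails `r⁻⁶`); (iii) ball overlap counting.  It is implied by the crux's full budget (`C = 0`) and never
compares energies ACROSS bond topologies (no competing phase enters). [conjecture] -/
theorem stub_elasticCoercivity :
    ∃ k : ℕ, 0 < k ∧ ∀ R η : ℝ, 0 < R → 0 < η → ∃ c' : ℝ, 0 < c' ∧ ∃ C : ℝ, 0 ≤ C ∧
      ∀ (N : ℕ) (x : Fin N → E3), IsGroundState lennardJones x →
        c' * (Nat.card {i : Fin N // BondGood k x i ∧ ¬ LayeredGood R η x i} : ℝ) ≤
          (interactionEnergy lennardJones x - (N : ℝ) * eStar) +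
            C * (Nat.card {i : Fin N // ¬ BondGood k x i} : ℝ) := by
  sorry

/-! ### The stub statements as named propositions (verbatim) -/

/-- Statement of `stub_bondOfLayered` (verbatim). [folklore] -/
def Sig.stub_bondOfLayered : Prop :=
    ∀ k : ℕ, 0 < k → ∃ R₀ : ℝ, ∀ R η : ℝ, R₀ ≤ R → 0 < η → η ≤ 1 / 20 →
      ∀ (N : ℕ) (x : Fin N → E3), IsGroundState lennardJones x →
        ∀ i : Fin N, LayeredGood R η x i → BondGood k x i

/-- Statement of `stub_elasticCoercivity` (verbatim). [conjecture] -/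
def Sig.stub_elasticCoercivity : Prop :=
    ∃ k : ℕ, 0 < k ∧ ∀ R η : ℝ, 0 < R → 0 < η → ∃ c' : ℝ, 0 < c' ∧ ∃ C : ℝ, 0 ≤ C ∧
      ∀ (N : ℕ) (x : Fin N → E3), IsGroundState lennardJones x →
        c' * (Nat.card {i : Fin N // BondGood k x i ∧ ¬ LayeredGood R η x i} : ℝ) ≤
          (interactionEnergy lennardJones x - (N : ℝ) * eStar) +
            C * (Nat.card {i : Fin N // ¬ BondGood k x i} : ℝ)

/-! ### The skeleton theorem: the rung BY NAME from the two stub statements (sorry-free) -/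

/-- **Assembly.** `stub_bondOfLayered → stub_elasticCoercivity → RebondingRung`.  Take the depth `k` of Stub 2 and
its radius `R₀(k)` from Stub 1.  Given FLOOR(P₀) and the rebonding budget to depth `k`, the FLOOR's full budget holds:
at the finer scale `(R₁, η₁) = (max R R₀, min η 1/20)` every `(R,η)`-bad site is `(R₁,η₁)`-bad, hence either
rebonded-and-bad (priced by the rebonding budget, constant `c₁`) or bond-good-and-bad (priced by elastic coercivity,
constant `c'`, with the debit `C · #{¬ BondGood k} ≤ C · #{rebonded-and-bad}` because `(R₁,η₁)`-good sites are
bond-good by Stub 1); `e(P₀) = e⋆` under FLOOR (`floor_iff_eq_eStar`).  So `#bad ≤ (1/c₁ + (1 + C/c₁)/c') · excess`,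
and the seed `FloorGivesLayered_proof` + the proved `PeriodicGivenLayered` give periodic windows. -/
theorem RebondingRung_of (h₁ : Sig.stub_bondOfLayered) (h₂ : Sig.stub_elasticCoercivity) : RebondingRung := by
  obtain ⟨k, hk, hEC⟩ := h₂
  obtain ⟨R₀, hR₀⟩ := h₁ k hk
  refine ⟨k, hk, fun P₀ hF hB x hx => ?_⟩
  refine Theses.FluxTubeKepler.PeriodicGivenLayered_holds x hx
    (Theorems.FluxTubeKeplerFloorGivesLayered.FloorGivesLayered_proof P₀ hF ?_ x hx)
  intro R η hR hη
  have hR₁ : 0 < max R R₀ := lt_max_of_lt_left hR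
  have hη₁ : 0 < min η (1 / 20) := lt_min hη (by norm_num)
  obtain ⟨c₁, hc₁, hB₁⟩ := hB (max R R₀) (min η (1 / 20)) hR₁ hη₁
  obtain ⟨c', hc', C, hC, hE₁⟩ := hEC (max R R₀) (min η (1 / 20)) hR₁ hη₁
  have heq := (Theorems.FluxTubeKeplerFloorGivesLayered.floor_iff_eq_eStar P₀).1 hF
  have hK : 0 < 1 / c₁ + (1 + C / c₁) / c' := by positivity
  refine ⟨1 / (1 / c₁ + (1 + C / c₁) / c'), by positivity, fun N y hy => ?_⟩
  show _ * (Nat.card {i : Fin N // ¬ LayeredGood R η y i} : ℝ) ≤ _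
  have hLG : ∀ i, LayeredGood (max R R₀) (min η (1 / 20)) y i → LayeredGood R η y i := fun i hi =>
    layeredGood_tol (min_le_left _ _) y i (layeredGood_mono (le_max_left _ _) y i hi)
  have hBG : ∀ i, LayeredGood (max R R₀) (min η (1 / 20)) y i → BondGood k y i :=
    hR₀ _ _ (le_max_right _ _) hη₁ (min_le_right _ _) N y hy
  have ha := hB₁ N y hy
  have hb := hE₁ N y hy
  rw [← heq] at hb
  have hX : 0 ≤ interactionEnergy lennardJones y - (N : ℝ) * P₀.energyPerParticle lennardJones :=
    sub_nonneg.2 (hF N y hy)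
  -- d ≤ a : every site that is not bond-good is (R₁,η₁)-bad (Stub 1, contrapositive)
  have hda : (Nat.card {i : Fin N // ¬ BondGood k y i} : ℝ) ≤
      Nat.card {i : Fin N // ¬ LayeredGood (max R R₀) (min η (1 / 20)) y i ∧ ¬ BondGood k y i} := by
    exact_mod_cast natCard_mono (p := fun i => ¬ BondGood k y i)
      (q := fun i => ¬ LayeredGood (max R R₀) (min η (1 / 20)) y i ∧ ¬ BondGood k y i)
      fun i hi => ⟨fun hg => hi (hBG i hg), hi⟩
  -- n ≤ a + b : an (R,η)-bad site is (R₁,η₁)-bad, and then either rebonded or bond-good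
  have hn : (Nat.card {i : Fin N // ¬ LayeredGood R η y i} : ℝ) ≤
      Nat.card {i : Fin N // ¬ LayeredGood (max R R₀) (min η (1 / 20)) y i ∧ ¬ BondGood k y i} +
        Nat.card {i : Fin N // BondGood k y i ∧ ¬ LayeredGood (max R R₀) (min η (1 / 20)) y i} := by
    have h1 := natCard_mono (p := fun i => ¬ LayeredGood R η y i)
      (q := fun i => (¬ LayeredGood (max R R₀) (min η (1 / 20)) y i ∧ ¬ BondGood k y i) ∨
        (BondGood k y i ∧ ¬ LayeredGood (max R R₀) (min η (1 / 20)) y i))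
      fun i hi => by
        have hi' : ¬ LayeredGood (max R R₀) (min η (1 / 20)) y i := fun hg => hi (hLG i hg)
        by_cases hg : BondGood k y i
        · exact Or.inr ⟨hg, hi'⟩
        · exact Or.inl ⟨hi', hg⟩
    have h2 := natCard_or_le (fun i => ¬ LayeredGood (max R R₀) (min η (1 / 20)) y i ∧ ¬ BondGood k y i)
      (fun i => BondGood k y i ∧ ¬ LayeredGood (max R R₀) (min η (1 / 20)) y i)
    exact_mod_cast h1.trans h2
  -- real arithmetic
  set X := interactionEnergy lennardJones y - (N : ℝ) * P₀.energyPerParticle lennardJones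
  set a := (Nat.card {i : Fin N // ¬ LayeredGood (max R R₀) (min η (1 / 20)) y i ∧ ¬ BondGood k y i} : ℝ)
  set b := (Nat.card {i : Fin N // BondGood k y i ∧ ¬ LayeredGood (max R R₀) (min η (1 / 20)) y i} : ℝ)
  set d := (Nat.card {i : Fin N // ¬ BondGood k y i} : ℝ)
  set n := (Nat.card {i : Fin N // ¬ LayeredGood R η y i} : ℝ)
  have ha' : a ≤ X / c₁ := by
    rw [le_div_iff₀ hc₁]
    linarith
  have hb' : b ≤ (X + C * (X / c₁)) / c' := by
    rw [le_div_iff₀ hc']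
    have : C * d ≤ C * (X / c₁) := mul_le_mul_of_nonneg_left (hda.trans ha') hC
    linarith
  have hnK : n ≤ X * (1 / c₁ + (1 + C / c₁) / c') := by
    have : X / c₁ + (X + C * (X / c₁)) / c' = X * (1 / c₁ + (1 + C / c₁) / c') := by ring
    linarith [hn, ha', hb']
  have key : ∀ K : ℝ, 0 < K → n ≤ X * K → 1 / K * n ≤ X := fun K hK' h =>
    calc 1 / K * n ≤ 1 / K * (X * K) := mul_le_mul_of_nonneg_left h (by positivity)
      _ = X := by field_simp
  exact key _ hK hnK

/-- **The closed skeleton instance**: the rung by name from the two declared stubs (the only `sorry`s of this file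
enter here). [conjecture] -/
theorem RebondingRung_skeleton : RebondingRung :=
  RebondingRung_of stub_bondOfLayered stub_elasticCoercivity

end Summit.AtomisticToContinuum.Crystallization.Cruxes.FluxCellKepler.BondLadder

end
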